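import Summits.BirchSwinnertonDyer.BirchSwinnertonDyer.Theorems.KimAtThreeFineKatoKPortJunctionDefs
import Summits.BirchSwinnertonDyer.BirchSwinnertonDyer.Theorems.KimAtThreeFineKatoKPortResidueNorm
import Literature.NumberTheory.NumberFields.KummerGeneratorsUnramified
import Mathlib.NumberTheory.Cyclotomic.Basic
import Mathlib.RingTheory.Trace.Basic
import HarnessLib

/-!
# K-PORT junction (T5), PROOFS: `K_w/ℚ_[p]` is GALOIS for `L = ℚ(ζ_m)`, `e(w∣p) = 1` for `p ∤ m`,
# (J3) `Tr_{K_w/ℚ_[p]} = e_p⁻¹ ∘ Tr_{L_w/ℚ_v}`, and hKloc's clause (d) at each factor `w ∣ 3`: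
# `Λ̃(E₀(K_w)) ⊆ 𝒪_w` and the UNIT-TRACE POINT `e₃⁻¹ Tr_{L_w/ℚ_v}(Λ̃ P) = padicLog X P₀`, `P₀ ∈ E₀(ℚ₃) ∖ E₁(ℚ₃)`
# (cell `bsd-addord`, seat w2-kport gen 2; `--supports stmt-BirchSwinnertonDyer-19560`, helper)

HONEST FRAMING. Route W2 (`route-BirchSwinnertonDyer-KimAtThreeKolyvagin`), crux 19560
`KatoKuriharaPortThreeShared`, registered line `perFactorKato`/`DefinedKato` (kim3 LEAD): hKloc clause
(d) = "per `w ∣ 3` of `L = ℚ(ζ_m)`: a log-lattice `Λ₀ʷ ⊆ 𝒪_w ∋ 0` and ONE factor with an element of unit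
trace" (`semiLocalInt_package_of_perFactor`, p495892, hypotheses `hΛ₀'`, `h0`, `hu'`), OWNER w2-kport (T5)
per planner g20 COORD/DEDUP 2026-08-27T04:59Z. The K-port proves the E-side of SAT₀ for an ABSTRACT normed
`ℚ_p`-algebra `K` (w2-kport gen 0/2, w2-acc4 gen 4: `KPort.consumer_of_addv`); `…KPortJunctionDefs` (this
seat) re-norms `L_w = w.1.adicCompletion L` as such a `K` (`KPort.Kw p L w`, ‖p‖ = p⁻¹, (J1), (J2), `hK`,
`NormedAlgebra ℚ_[p]` under `Fact (e(w∣p) = 1)`, `FiniteDimensional ℚ_[p]`). THIS FILE supplies the three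
remaining structure facts and the clause-(d) data:

* §1 `Kw.isCyclotomicExtension_completion` (`L/ℚ` `{m}`-cyclotomic ⇒ `K_w/ℚ_v` `{m}`-cyclotomic: the image
  of `ζ_m`, and `L_w = ℚ_v · L` by the packet's `baseChange_bijective`), `Kw.isGalois_completion`,
  **`Kw.isGalois`** (`IsGalois ℚ_[p] K_w`, transport along `e_p` by Mathlib `IsGalois.of_equiv_equiv`),
  **`Kw.trace_eq`** ((J3), Mathlib `Algebra.trace_eq_of_equiv_equiv`);
* §2 **`Kw.ramificationIdx_eq_one_of_isCyclotomicExtension`** (`p ∤ m ⇒ e(w∣p) = 1`: the tree's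
  `ramificationIdx_eq_one_of_adjoin_radicals` — `ℚ(ζ_m)` is generated by the radical `ζ_m` of the unit `1`
  and `m ∉ w`);
* §3 **`clause_d_data`** (p = 3): for `W/ℚ` globally minimal with `Addv W 3` and `e(w∣3) = 1`:
  (d1) `Λ̃ Q ∈ 𝒪_w` for all `Q ∈ E₀(K_w)` ((J1) ∘ `consumer_of_addv` (b)); (d2) `∃ P ∈ E₀(K_w)`,
  `∃ P₀ ∈ E₀(ℚ₃) ∖ E₁(ℚ₃)`, `e₃⁻¹(Tr_{L_w/ℚ_v}(Λ̃ P)) = padicLog X P₀` ((J3) ∘ `consumer_of_addv` (a)).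
  kim3's (δ) at `ℚ₃` (`KimAtThreeFineKatoSATPoints.mem_formalFiltration_zero_of_norm_padicLog_le`, `t = 0`)
  turns (d2) into `‖e₃⁻¹ Tr ℓ₀‖ = 1`; `0 = Λ̃ 0 ∈ Λ₀ʷ` is `map_zero`. `Λ̃ = KPort.satLog 3 (Kw 3 L w) M`,
  `M = W_ℤ ⊗ ℤ₃`, read in `L_w` through the identity `Kw.toCompletion`. **`clause_d_package`**: the same
  with `Λ₀ʷ` spelled out as the SET `{Λ̃ P : P ∈ E₀(K_w)} ⊆ L_w` — exactly the `hΛ₀' w`, `h0 w` and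
  (modulo (δ)) `hu'` inputs of `semiLocalInt_package_of_perFactor`.
* §4 the structure facts restated on `w.1.adicCompletion L` itself (`Kw` is definitionally it, with the
  packet's instances): `Kw.isCyclotomicExtension_adicCompletion`, `Kw.isGalois_adicCompletion`,
  `Kw.valued_natCast_prime_adicCompletion`, `Kw.valued_le_valued_prime_of_lt_one` (valuation-form `hK`).

TOOL theorems only (no definition, no named fact, no `sorry`); closes nothing by itself; nothing booked;
BSD / 19560 are not proved by any of this. What hKloc still needs is unchanged elsewhere ((a) R-κ,
(b)/(c) hker/hdual, (e) exp*-lattice, (f) COMPAT, (g) ZetaBody — kim3 memo KIM3-W2-C1c-SEMILOCAL-g14 §7).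

References: J. W. S. Cassels, A. Fröhlich, *Algebraic Number Theory* (1967), Ch. II §10 [CasselsFrohlichANT1967];
S. Lang, *Fundamentals of Diophantine Geometry* (1983), Ch. 6 Prop. 1.3 [Lang1983]; J. H. Silverman,
*The Arithmetic of Elliptic Curves*, 2nd ed. (2009), IV.6.4, VII.2 [SilvermanAEC2009]; kim3 memo §3.
-/

noncomputable section

-- the cell's Theorems namespace `Summit.BirchSwinnertonDyer.BirchSwinnertonDyer.…` repeats the summit name by design (D-0017)
set_option linter.dupNamespace false

open scoped NNReal
open IsDedekindDomain NumberField WithZeroMulInt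

namespace Summit.BirchSwinnertonDyer.BirchSwinnertonDyer.Theorems.KPort

open Literature.NumberTheory.GaloisRepresentations.LubinTate (unitBall mem_unitBall_iff)

variable (p : ℕ) [hp : Fact p.Prime] (L : Type) [Field L] [NumberField L]
  (w : ((Rat.HeightOneSpectrum.primesEquiv (R := 𝓞 ℚ)).symm ⟨p, hp.out⟩).Extension (𝓞 L))

/-! ## §1 `L_w/ℚ_v` is cyclotomic, hence Galois; `K_w/ℚ_[p]` is Galois; (J3) trace -/

namespace Kw

variable {p L w}

/-- **`L_w/ℚ_v` is a cyclotomic extension** when `L/ℚ` is `{m}`-cyclotomic: the image of a primitive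
`m`-th root of unity of `L` is one of `L_w`, and `L_w = ℚ_v · L` (the packet's base change
`L ⊗ ℚ_v ≅ ∏ L_w` is onto). [cite: CasselsFrohlichANT1967, Ch. II §10] -/
theorem isCyclotomicExtension_completion (m : ℕ) [NeZero m] [IsCyclotomicExtension {m} ℚ L] :
    IsCyclotomicExtension {m} (((Rat.HeightOneSpectrum.primesEquiv (R := 𝓞 ℚ)).symm ⟨p, hp.out⟩).adicCompletion ℚ)
      (Kw p L w) where
  exists_isPrimitiveRoot := fun {n} hn hn0 => by
    rw [Set.mem_singleton_iff] at hn
    subst hn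
    obtain ⟨ζ, hζ⟩ := IsCyclotomicExtension.exists_isPrimitiveRoot ℚ L (Set.mem_singleton n) hn0
    exact ⟨(toCompletion p L w).symm (algebraMap L (w.1.adicCompletion L) ζ),
      (hζ.map_of_injective (algebraMap L (w.1.adicCompletion L)).injective).map_of_injective
        (toCompletion p L w).symm.injective⟩
  adjoin_roots := fun x => by
    classical
    -- every element of `L` maps into `T := ℚ_v[roots of unity of order m in K_w]`
    have hL : ∀ a : L, (toCompletion p L w).symm (algebraMap L (w.1.adicCompletion L) a) ∈
        Algebra.adjoin (((Rat.HeightOneSpectrum.primesEquiv (R := 𝓞 ℚ)).symm ⟨p, hp.out⟩).adicCompletion ℚ)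
          {b : Kw p L w | ∃ n : ℕ, n ∈ ({m} : Set ℕ) ∧ n ≠ 0 ∧ b ^ n = 1} := by
      intro a
      have ha := IsCyclotomicExtension.adjoin_roots (S := ({m} : Set ℕ)) (A := ℚ) (B := L) a
      induction ha using Algebra.adjoin_induction with
      | mem b hb =>
        obtain ⟨n, hn, hn0, hbn⟩ := hb
        refine Algebra.subset_adjoin ⟨n, hn, hn0, ?_⟩
        rw [← map_pow, ← map_pow, hbn, map_one, map_one]
      | algebraMap q =>
        have e : (toCompletion p L w).symm (algebraMap L (w.1.adicCompletion L) (algebraMap ℚ L q)) =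
            algebraMap (((Rat.HeightOneSpectrum.primesEquiv (R := 𝓞 ℚ)).symm ⟨p, hp.out⟩).adicCompletion ℚ) (Kw p L w) (q : ((Rat.HeightOneSpectrum.primesEquiv (R := 𝓞 ℚ)).symm ⟨p, hp.out⟩).adicCompletion ℚ) := by
          apply (toCompletion p L w).injective
          rw [RingEquiv.apply_symm_apply, algebraMap_completion_eq, map_ratCast, eq_ratCast, map_ratCast]
        rw [e]
        exact Subalgebra.algebraMap_mem _ _
      | add a b _ _ ha hb => rw [map_add, map_add]; exact add_mem ha hb
      | mul a b _ _ ha hb => rw [map_mul, map_mul]; exact mul_mem ha hb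
    -- `x` comes from `L ⊗ ℚ_v`
    obtain ⟨t, ht⟩ := (HeightOneSpectrum.adicCompletion.baseChange_bijective ℚ L (𝓞 L) ((Rat.HeightOneSpectrum.primesEquiv (R := 𝓞 ℚ)).symm ⟨p, hp.out⟩)).2
      (Function.update (0 : ∀ w' : ((Rat.HeightOneSpectrum.primesEquiv (R := 𝓞 ℚ)).symm ⟨p, hp.out⟩).Extension (𝓞 L), w'.1.adicCompletion L) w (toCompletion p L w x))
    have hx : x = (toCompletion p L w).symm (HeightOneSpectrum.adicCompletion.baseChange ℚ L (𝓞 L) ((Rat.HeightOneSpectrum.primesEquiv (R := 𝓞 ℚ)).symm ⟨p, hp.out⟩) t w) := by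
      rw [ht, Function.update_self]; rfl
    rw [hx]
    clear hx ht
    induction t using TensorProduct.induction_on with
    | zero => rw [map_zero, Pi.zero_apply, map_zero]; exact zero_mem _
    | tmul a b =>
      rw [HeightOneSpectrum.adicCompletion.baseChange_tmul_apply, map_mul]
      exact mul_mem (hL a) (Subalgebra.algebraMap_mem _ b)
    | add s t hs ht => rw [map_add, Pi.add_apply, map_add]; exact add_mem hs ht

/-- **`L_w/ℚ_v` is Galois** for `L/ℚ` cyclotomic. [cite: CasselsFrohlichANT1967, Ch. II §10] -/
theorem isGalois_completion (m : ℕ) [NeZero m] [IsCyclotomicExtension {m} ℚ L] :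
    IsGalois (((Rat.HeightOneSpectrum.primesEquiv (R := 𝓞 ℚ)).symm ⟨p, hp.out⟩).adicCompletion ℚ) (Kw p L w) :=
  haveI := isCyclotomicExtension_completion (p := p) (L := L) (w := w) m
  IsCyclotomicExtension.isGalois {m} _ _

/-- **`K_w/ℚ_[p]` is Galois** for `L/ℚ` cyclotomic (transport along `e_p : ℚ_[p] ≅ ℚ_v`, Mathlib
`IsGalois.of_equiv_equiv`). [cite: CasselsFrohlichANT1967, Ch. II §10] -/
theorem isGalois (m : ℕ) [NeZero m] [IsCyclotomicExtension {m} ℚ L] : IsGalois ℚ_[p] (Kw p L w) := by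
  haveI := isGalois_completion (p := p) (L := L) (w := w) m
  exact IsGalois.of_equiv_equiv (F := ((Rat.HeightOneSpectrum.primesEquiv (R := 𝓞 ℚ)).symm ⟨p, hp.out⟩).adicCompletion ℚ)
    (E := Kw p L w) (f := (Padic.adicCompletionEquiv (𝓞 ℚ) ⟨p, hp.out⟩).toRingEquiv.symm)
    (g := RingEquiv.refl (Kw p L w)) (RingHom.ext fun y => by
      simp only [RingHom.coe_comp, Function.comp_apply, RingEquiv.coe_toRingHom, RingEquiv.refl_apply]
      change algebraMap _ (Kw p L w) ((Padic.adicCompletionEquiv (𝓞 ℚ) ⟨p, hp.out⟩)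
        ((Padic.adicCompletionEquiv (𝓞 ℚ) ⟨p, hp.out⟩).toRingEquiv.symm y)) = _
      rw [show (Padic.adicCompletionEquiv (𝓞 ℚ) ⟨p, hp.out⟩) ((Padic.adicCompletionEquiv (𝓞 ℚ) ⟨p, hp.out⟩).toRingEquiv.symm y)
        = y from (Padic.adicCompletionEquiv (𝓞 ℚ) ⟨p, hp.out⟩).toRingEquiv.apply_symm_apply y])

/-- **(J3) trace compatibility**: `Tr_{K_w/ℚ_[p]} = e_p⁻¹ ∘ Tr_{L_w/ℚ_v}`. [cite: CasselsFrohlichANT1967, Ch. II §10] -/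
theorem trace_eq (x : Kw p L w) :
    Algebra.trace ℚ_[p] (Kw p L w) x = (Padic.adicCompletionEquiv (𝓞 ℚ) ⟨p, hp.out⟩).symm
      (Algebra.trace (((Rat.HeightOneSpectrum.primesEquiv (R := 𝓞 ℚ)).symm ⟨p, hp.out⟩).adicCompletion ℚ)
        (w.1.adicCompletion L) (toCompletion p L w x)) := by
  have h := Algebra.trace_eq_of_equiv_equiv (Padic.adicCompletionEquiv (𝓞 ℚ) ⟨p, hp.out⟩).toRingEquiv
    (toCompletion p L w) (RingHom.ext fun y => rfl) x
  rw [h]; rfl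

end Kw

/-! ## §2 `e(w∣p) = 1` for `ℚ(ζ_m)`, `p ∤ m` -/

namespace Kw

variable {p L w}

/-- **`w` is unramified over `p` in a cyclotomic field of level prime to `p`**: `e(w∣p) = 1` for
`L/ℚ` `{m}`-cyclotomic and `p ∤ m` (`L = ℚ(ζ_m)` is generated by the radical `ζ_m` of the unit `1`,
`ζ_m^m = 1`, and `m ∉ w`: the tree's `ramificationIdx_eq_one_of_adjoin_radicals`, Lang, *Fundamentals of
Diophantine Geometry* Ch. 6 Prop. 1.3). [cite: Lang1983, Ch. 6 Prop. 1.3] -/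
theorem ramificationIdx_eq_one_of_isCyclotomicExtension (m : ℕ) [NeZero m] [IsCyclotomicExtension {m} ℚ L]
    (hpm : ¬ p ∣ m) : w.1.asIdeal.ramificationIdx (𝓞 ℚ) = 1 := by
  haveI : IsGalois ℚ L := IsCyclotomicExtension.isGalois {m} ℚ L
  obtain ⟨ζ, hζ⟩ := IsCyclotomicExtension.exists_isPrimitiveRoot ℚ L (Set.mem_singleton m) (NeZero.ne m)
  refine Literature.NumberTheory.NumberFields.ramificationIdx_eq_one_of_adjoin_radicals w.1 (S := {ζ})
    (IntermediateField.adjoin_eq_top_of_algebra ℚ _ (IsCyclotomicExtension.adjoin_primitive_root_eq_top hζ)) ?_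
  intro α hα
  rw [Set.mem_singleton_iff] at hα
  subst hα
  refine ⟨m, 1, ?_, by rw [map_one], by rw [map_one]; exact hζ.pow_eq_one⟩
  -- `m ∉ w`: otherwise `m ∈ w ∩ ℤ = (p)`, i.e. `p ∣ m`
  intro hm
  apply hpm
  have hv : ((m : ℕ) : 𝓞 ℚ) ∈ (w.1.under (𝓞 ℚ)).asIdeal := by
    rw [HeightOneSpectrum.under_asIdeal, Ideal.under, Ideal.mem_comap, map_natCast]
    exact hm
  rw [w.2] at hv
  have hnat : Rat.HeightOneSpectrum.natGenerator ((Rat.HeightOneSpectrum.primesEquiv (R := 𝓞 ℚ)).symm ⟨p, hp.out⟩) = p :=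
    congrArg Subtype.val ((Rat.HeightOneSpectrum.primesEquiv (R := 𝓞 ℚ)).apply_symm_apply ⟨p, hp.out⟩)
  have h := (Literature.NumberTheory.DiophantineGeometry.UniformABCConjecture.natCast_mem_asIdeal_iff _ m).mp hv
  rwa [hnat] at h

end Kw

/-! ## §3 hKloc clause (d) at the factor `w` (p = 3): `Λ̃(E₀(K_w)) ⊆ 𝒪_w` and the unit-trace point -/

section ClauseD

open Summit.BirchSwinnertonDyer.Rank1Residual.Additive Summit.BirchSwinnertonDyer.Rank1Residual.Additive.BallEval
open Summit.BirchSwinnertonDyer.Rank1Residual.Additive.LocalLog Literature.NumberTheory.EllipticCurves.Rank1Residual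
open WeierstrassCurve

variable {L : Type} [Field L] [NumberField L]
  (w : ((Rat.HeightOneSpectrum.primesEquiv (R := 𝓞 ℚ)).symm ⟨3, Fact.out⟩).Extension (𝓞 L))

/-- **hKloc clause (d) data at the factor `w`** (kim3 `semiLocalInt_package_of_perFactor`, hypotheses
`hΛ₀'`/`hu'` with `Λ₀ʷ := Λ̃(E₀(K_w))`): for `W/ℚ` globally minimal with `Addv W 3`, `L/ℚ` `{m}`-cyclotomic
with `3 ∤ m` (so `e(w∣3) = 1`, supplied as a `Fact` — `Kw.ramificationIdx_eq_one_of_isCyclotomicExtension`),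
(d1) `Λ̃ Q ∈ 𝒪_w` for every `Q ∈ E₀(K_w)`; (d2) some `P ∈ E₀(K_w)` and `P₀ ∈ E₀(ℚ₃) ∖ E₁(ℚ₃)` have
`e₃⁻¹(Tr_{L_w/ℚ_v}(Λ̃ P)) = padicLog X P₀` — w2-acc4's `consumer_of_addv` at `K := K_w` composed with
(J1)/(J3); kim3's (δ) turns the right-hand side into a `3`-adic unit on the Kato stratum.
[cite: SilvermanAEC2009, IV.6.4, VII.2 Prop. 2.1–2.2] -/
theorem clause_d_data (m : ℕ) [NeZero m] [IsCyclotomicExtension {m} ℚ L]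
    [he : Fact (w.1.asIdeal.ramificationIdx (𝓞 ℚ) = 1)]
    (W : WeierstrassCurve ℚ) [W.IsElliptic] [W.IsGloballyMinimal]
    [hE : (((integralModelInt W).map (Int.castRingHom ℤ_[3])).map PadicInt.Coe.ringHom).IsElliptic]
    [hX : (((integralModelInt W).map (Int.castRingHom ℤ_[3])).map PadicInt.Coe.ringHom).IsIntegral ℤ_[3]]
    [hX' : (((integralModelInt W).map (Int.castRingHom ℤ_[3])).map PadicInt.Coe.ringHom).IsIntegral
      (NormedField.valuation (K := ℚ_[3])).integer]
    [hmin : (((integralModelInt W).map (Int.castRingHom ℤ_[3])).map PadicInt.Coe.ringHom).IsMinimal ℤ_[3]]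
    [hint : (curveK 3 (Kw 3 L w) ((integralModelInt W).map (Int.castRingHom ℤ_[3]))).IsIntegral
      (NormedField.valuation (K := Kw 3 L w)).integer]
    (hadd : Addv W 3) :
    (∀ Q ∈ (((integralModelInt W).map (Int.castRingHom ℤ_[3])).map (coeffHom 3 (Kw 3 L w))).nonsingularReductionSubgroup
        (Valuation.integer.integers (NormedField.valuation (K := Kw 3 L w))),
      Kw.toCompletion 3 L w (satLog 3 (Kw 3 L w) ((integralModelInt W).map (Int.castRingHom ℤ_[3])) Q) ∈
        w.1.adicCompletionIntegers L) ∧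
    (∃ P ∈ (((integralModelInt W).map (Int.castRingHom ℤ_[3])).map (coeffHom 3 (Kw 3 L w))).nonsingularReductionSubgroup
        (Valuation.integer.integers (NormedField.valuation (K := Kw 3 L w))),
      ∃ P₀ : (((integralModelInt W).map (Int.castRingHom ℤ_[3])).map PadicInt.Coe.ringHom).toAffine.Point,
        P₀ ∈ (((integralModelInt W).map (Int.castRingHom ℤ_[3])).map PadicInt.Coe.ringHom).goodReductionSubgroup ℤ_[3] ∧
        ¬ (((integralModelInt W).map (Int.castRingHom ℤ_[3])).map PadicInt.Coe.ringHom).IsInReductionKernel P₀ ∧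
        (Padic.adicCompletionEquiv (𝓞 ℚ) ⟨3, Fact.out⟩).symm
            (Algebra.trace (((Rat.HeightOneSpectrum.primesEquiv (R := 𝓞 ℚ)).symm ⟨3, Fact.out⟩).adicCompletion ℚ)
              (w.1.adicCompletion L)
              (Kw.toCompletion 3 L w (satLog 3 (Kw 3 L w) ((integralModelInt W).map (Int.castRingHom ℤ_[3])) P))) =
          padicLog (((integralModelInt W).map (Int.castRingHom ℤ_[3])).map PadicInt.Coe.ringHom) P₀) := by
  haveI := Kw.isGalois (p := 3) (L := L) (w := w) m
  have hK : ∀ x : Kw 3 L w, ‖x‖ < 1 → ‖x‖ ≤ ‖((3 : ℕ) : Kw 3 L w)‖ :=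
    Kw.norm_le_norm_prime_of_norm_lt_one (p := 3) he.out
  obtain ⟨⟨P, hP, P₀, hP₀, hnot, -, htr⟩, hb⟩ := consumer_of_addv (K := Kw 3 L w) W hadd hK
  refine ⟨fun Q hQ => ?_, P, hP, P₀, hP₀, hnot, ?_⟩
  · rw [← Kw.mem_unitBall_iff_mem_adicCompletionIntegers, mem_unitBall_iff]
    exact hb Q hQ
  · rw [← Kw.trace_eq]
    exact htr

end ClauseD

section ClauseDPackage

open Summit.BirchSwinnertonDyer.Rank1Residual.Additive Summit.BirchSwinnertonDyer.Rank1Residual.Additive.BallEval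
open Summit.BirchSwinnertonDyer.Rank1Residual.Additive.LocalLog Literature.NumberTheory.EllipticCurves.Rank1Residual
open WeierstrassCurve

variable {L : Type} [Field L] [NumberField L]
  (w : ((Rat.HeightOneSpectrum.primesEquiv (R := 𝓞 ℚ)).symm ⟨3, Fact.out⟩).Extension (𝓞 L))

open scoped Classical in
/-- **hKloc clause (d), PACKAGED at the factor `w`** with the log-lattice spelled out as the SET
`Λ₀ʷ := {Λ̃ P : P ∈ E₀(K_w)} ⊆ L_w` (the shape of kim3's `semiLocalInt_package_of_perFactor` hypotheses
`hΛ₀' w` / `h0 w` / the `∃ ℓ₀ ∈ Λ₀' w₀` of `hu'`): `Λ₀ʷ ⊆ 𝒪_w`, `0 ∈ Λ₀ʷ` (`Λ̃ O = 0`), and some `ℓ₀ ∈ Λ₀ʷ`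
has `e₃⁻¹(Tr_{L_w/ℚ_v} ℓ₀) = padicLog X P₀` for a `P₀ ∈ E₀(ℚ₃) ∖ E₁(ℚ₃)` (kim3's (δ) at `t = 0` then gives
`‖e₃⁻¹(Tr ℓ₀)‖ = 1`). [cite: SilvermanAEC2009, IV.6.4, VII.2 Prop. 2.1–2.2] -/
theorem clause_d_package (m : ℕ) [NeZero m] [IsCyclotomicExtension {m} ℚ L]
    [he : Fact (w.1.asIdeal.ramificationIdx (𝓞 ℚ) = 1)]
    (W : WeierstrassCurve ℚ) [W.IsElliptic] [W.IsGloballyMinimal]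
    [hE : (((integralModelInt W).map (Int.castRingHom ℤ_[3])).map PadicInt.Coe.ringHom).IsElliptic]
    [hX : (((integralModelInt W).map (Int.castRingHom ℤ_[3])).map PadicInt.Coe.ringHom).IsIntegral ℤ_[3]]
    [hX' : (((integralModelInt W).map (Int.castRingHom ℤ_[3])).map PadicInt.Coe.ringHom).IsIntegral
      (NormedField.valuation (K := ℚ_[3])).integer]
    [hmin : (((integralModelInt W).map (Int.castRingHom ℤ_[3])).map PadicInt.Coe.ringHom).IsMinimal ℤ_[3]]
    [hint : (curveK 3 (Kw 3 L w) ((integralModelInt W).map (Int.castRingHom ℤ_[3]))).IsIntegral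
      (NormedField.valuation (K := Kw 3 L w)).integer]
    (hadd : Addv W 3) :
    ({x : w.1.adicCompletion L | ∃ P ∈ (((integralModelInt W).map (Int.castRingHom ℤ_[3])).map
          (coeffHom 3 (Kw 3 L w))).nonsingularReductionSubgroup
          (Valuation.integer.integers (NormedField.valuation (K := Kw 3 L w))),
        Kw.toCompletion 3 L w (satLog 3 (Kw 3 L w) ((integralModelInt W).map (Int.castRingHom ℤ_[3])) P) = x} ⊆
      w.1.adicCompletionIntegers L) ∧
    ((0 : w.1.adicCompletion L) ∈
      {x : w.1.adicCompletion L | ∃ P ∈ (((integralModelInt W).map (Int.castRingHom ℤ_[3])).map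
          (coeffHom 3 (Kw 3 L w))).nonsingularReductionSubgroup
          (Valuation.integer.integers (NormedField.valuation (K := Kw 3 L w))),
        Kw.toCompletion 3 L w (satLog 3 (Kw 3 L w) ((integralModelInt W).map (Int.castRingHom ℤ_[3])) P) = x}) ∧
    (∃ ℓ₀ ∈ {x : w.1.adicCompletion L | ∃ P ∈ (((integralModelInt W).map (Int.castRingHom ℤ_[3])).map
          (coeffHom 3 (Kw 3 L w))).nonsingularReductionSubgroup
          (Valuation.integer.integers (NormedField.valuation (K := Kw 3 L w))),
        Kw.toCompletion 3 L w (satLog 3 (Kw 3 L w) ((integralModelInt W).map (Int.castRingHom ℤ_[3])) P) = x},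
      ∃ P₀ : (((integralModelInt W).map (Int.castRingHom ℤ_[3])).map PadicInt.Coe.ringHom).toAffine.Point,
        P₀ ∈ (((integralModelInt W).map (Int.castRingHom ℤ_[3])).map PadicInt.Coe.ringHom).goodReductionSubgroup ℤ_[3] ∧
        ¬ (((integralModelInt W).map (Int.castRingHom ℤ_[3])).map PadicInt.Coe.ringHom).IsInReductionKernel P₀ ∧
        (Padic.adicCompletionEquiv (𝓞 ℚ) ⟨3, Fact.out⟩).symm
            (Algebra.trace (((Rat.HeightOneSpectrum.primesEquiv (R := 𝓞 ℚ)).symm ⟨3, Fact.out⟩).adicCompletion ℚ)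
              (w.1.adicCompletion L) ℓ₀) =
          padicLog (((integralModelInt W).map (Int.castRingHom ℤ_[3])).map PadicInt.Coe.ringHom) P₀) := by
  obtain ⟨h1, P, hP, P₀, hP₀, hnot, htr⟩ := clause_d_data w m W hadd
  have h0 : satLog 3 (Kw 3 L w) ((integralModelInt W).map (Int.castRingHom ℤ_[3]))
      (0 : (curveK 3 (Kw 3 L w) ((integralModelInt W).map (Int.castRingHom ℤ_[3]))).toAffine.Point) = 0 :=
    satLog_zero
  refine ⟨?_, ⟨(0 : (curveK 3 (Kw 3 L w) ((integralModelInt W).map (Int.castRingHom ℤ_[3]))).toAffine.Point),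
    AddSubgroup.zero_mem _, by rw [h0, map_zero]⟩, ?_⟩
  · rintro x ⟨Q, hQ, rfl⟩
    exact h1 Q hQ
  · exact ⟨_, ⟨P, hP, rfl⟩, P₀, hP₀, hnot, htr⟩

end ClauseDPackage

/-! ## §4 The same structure facts in the PACKET currency `w.1.adicCompletion L` (for citation by name;
`Kw p L w` is definitionally `w.1.adicCompletion L` with the packet's own instances) -/

namespace Kw

variable {p L w}

/-- (G) **`L_w/ℚ_v` is `{m}`-cyclotomic** for `L/ℚ` `{m}`-cyclotomic, stated on `w.1.adicCompletion L`
itself. [cite: CasselsFrohlichANT1967, Ch. II §10] -/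
theorem isCyclotomicExtension_adicCompletion (m : ℕ) [NeZero m] [IsCyclotomicExtension {m} ℚ L] :
    IsCyclotomicExtension {m} (((Rat.HeightOneSpectrum.primesEquiv (R := 𝓞 ℚ)).symm ⟨p, hp.out⟩).adicCompletion ℚ)
      (w.1.adicCompletion L) :=
  isCyclotomicExtension_completion (p := p) (L := L) (w := w) m

/-- (G) **`L_w/ℚ_v` is Galois** for `L/ℚ` cyclotomic, stated on `w.1.adicCompletion L`.
[cite: CasselsFrohlichANT1967, Ch. II §10] -/
theorem isGalois_adicCompletion (m : ℕ) [NeZero m] [IsCyclotomicExtension {m} ℚ L] :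
    IsGalois (((Rat.HeightOneSpectrum.primesEquiv (R := 𝓞 ℚ)).symm ⟨p, hp.out⟩).adicCompletion ℚ)
      (w.1.adicCompletion L) :=
  isGalois_completion (p := p) (L := L) (w := w) m

/-- (U) **`v_w(p) = exp(−e(w∣p))`** on `w.1.adicCompletion L`. [cite: CasselsFrohlichANT1967, Ch. II §10] -/
theorem valued_natCast_prime_adicCompletion :
    Valued.v ((p : ℕ) : w.1.adicCompletion L) =
      (WithZero.exp (-(w.1.asIdeal.ramificationIdx (𝓞 ℚ) : ℤ)) : WithZero (Multiplicative ℤ)) :=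
  valued_natCast_prime (p := p) (L := L) (w := w)

/-- (U) **`hK` in valuation form** for `w` unramified over `p`: `v_w(x) < 1 ⇒ v_w(x) ≤ v_w(p)` on
`w.1.adicCompletion L`. [cite: SerreLocalFields1979, Ch. II §1] -/
theorem valued_le_valued_prime_of_lt_one (he : w.1.asIdeal.ramificationIdx (𝓞 ℚ) = 1)
    (x : w.1.adicCompletion L) (hx : Valued.v x < (1 : WithZero (Multiplicative ℤ))) :
    Valued.v x ≤ Valued.v ((p : ℕ) : w.1.adicCompletion L) := by
  rw [valued_natCast_prime_adicCompletion (p := p), he]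
  by_cases hx0 : (Valued.v x : WithZero (Multiplicative ℤ)) = 0
  · rw [hx0]; exact zero_le
  have hlog : WithZero.log (Valued.v x : WithZero (Multiplicative ℤ)) ≤ -1 := by
    have h0 : WithZero.log (Valued.v x : WithZero (Multiplicative ℤ)) < 0 :=
      (WithZero.log_lt_iff_lt_exp hx0).mpr (by rw [WithZero.exp_zero]; exact hx)
    omega
  rw [← WithZero.exp_log hx0]
  exact WithZero.exp_le_exp.mpr (by exact_mod_cast hlog)

end Kw

end Summit.BirchSwinnertonDyer.BirchSwinnertonDyer.Theorems.KPort

end
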